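import Literature.MathematicalPhysics.QuantumFieldTheory.Balaban1983to89.Node00.OpsYDeltaPrimeAFactor

/-!
# (3.152) and (3.124) at the `OpsY` letters REDUCE to one constraint — Balaban, Commun. Math. Phys. **99** (1985) 389–434, pp. 420, 425–426

[cite: Balaban1985BackgroundPropagators, (3.122) p.420, (3.124) p.420, (3.128) p.421, (3.134) p.422, (3.147)–(3.152) pp.425–426, (3.115) p.418]

Print (p. 426): *«RD\*G₁ = RG′D\*, and G₁DR = DG′R (3.152) … QG₁DR = QDG′R = D₁Q′G′R = 0»* — the second chain uses (3.115)
`Q_jD_U = D_{Ū,j}Q′_j` and `Q′G′R = 0`.  At def-Y's typed letters (`Node00.OpsYSectDE`: `deltaOneY = Δ_π − Δ⁽²⁾_π + DRD* + Q*aQ`,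
`G1Y = Ring.inverse deltaOneY`; `Γ := GpPhysY i (parSymY i)` = print's `G′` in print's units, `R := RY i (parSymY i) Γ`) this file proves the
ALGEBRA of that paragraph and isolates exactly what is NOT algebra:

* §1 (the two one-line Gaussian computations behind (3.151)): with `M₁ := deltaOneY …`,
  `(R Γ D*) ∘ M₁ = R D* + (R Γ D*) ∘ (Q* a Q)` and `M₁ ∘ (D Γ R) = D R + (Q* a Q) ∘ (D Γ R)` — because `R Γ D*` kills the range of
  `π† = 1 − DRΓD*` and `R Γ D* D R = R` (`Node00.OpsYDeltaPrimeAFactor`), and symmetrically `π ∘ DΓR = 0`, `R D* D Γ R = R`.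
* §2: hence, wherever `M₁` is invertible ((3.138), not claimed), the five displayed identities of the N06 knit —
  (3.152) `R D* G₁ = R Γ D*`, `G₁ D R = D Γ R` (`B9Thm313WholeRgdFrom3152.Ids3152`) and (3.124) `Q G₁ D R = 0`, `R D* G₁ Q* = 0`,
  `R D* G₁ D R = R` (`B9Thm312WholeIdentitiesSplit.Ids3124`) — all follow from the ONE pair of constraints
  `hZ : Q ∘ D ∘ Γ ∘ R = 0` (print's «QDG′R = D₁Q′G′R = 0», i.e. (3.115) composed with `Q′G′R = 0`) and its transpose
  `hZt : R ∘ Γ ∘ D* ∘ Q* = 0`; `hZ` alone already gives `G₁DR = DΓR`, `QG₁DR = 0`, `RD*G₁DR = R`.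
* §3: and `hZt` FOLLOWS from `hZ` at a `G`-valued bond transporter table — `Q*`, `D*` are the trace-adjoints of `Q`, `D` ((3.13), (3.8):
  dag-n06-j's `isAdjTr_QY_QsY`, `isAdjTr_gradY_divY`), `Γ`, `R` are symmetric, the pairing is nondegenerate (`eq_zero_of_isAdjTr_eq_zero`) —
  so the knit needs ONE binder: ★★★ `ids3152_ids3124_of_hZ` (any `G`-valued `parB`), `ids3152_ids3124_of_hZ_parBY` (def-Y's taxicab table).

HONEST STATUS.  `hZ` is NOT an identity of the typed covariant averaging `QY` at a curved background (def-Y's located gap O5: the typed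
`Q(U)D_U` differs from `D_{Ū}Q′(U)` by the holonomy defect of the block paths; it holds at `U = 1`), so (3.152)/(3.124) at these letters are
displayed CONSTRAINTS of the knit, reduced here from five to ONE; nothing of (3.138) or of [B9]'s estimates is asserted; 0 `def`.
The `LatticeK`-letter twin of this reduction is `B9Eq3119DeltaPiTower` («modulo (3.115) only»).
-/

namespace Literature.MathematicalPhysics.QuantumFieldTheory.Balaban1983to89.Node00

open B6KLevelCensusIndexV1 (KIdx)
open B9Eq3132SectDLetters (gaugePiY gaugePiTY)
open B9Thm311ReadingCoords (trIP IsSymmTr IsAdjTr trIP_zero_right)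
open B9Ineq349SiteAdjoint (trIP_comm)
open B9Thm311AdjointPairs (isAdjTr_gradY_divY isAdjTr_QY_QsY)
open B9Thm311ProjectionR (RY_parSymY_isSymmTr)
open B9Thm311DeltaPrimePos (trIP_self_pos)
open scoped Matrix

noncomputable section

variable {d ℓ : ℕ} {hd : 1 ≤ d + 1} {hL : Odd (ℓ + 1) ∧ 1 < ℓ + 1} {b₀ b₁ : ℝ}

section Reduction

open scoped Matrix.Norms.L2Operator

variable {N : ℕ} (i : KIdx d ℓ hd hL b₀ b₁) {G : Subgroup (Matrix (Fin N) (Fin N) ℂ)ˣ}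

/-! ## §1 The two Gaussian computations of (3.151): `RΓD* ∘ M₁` and `M₁ ∘ DΓR` -/

/-- ★★ **`(R Γ D*) ∘ G₁⁻¹ = R D* + (R Γ D*) ∘ (Q* a Q)`** for `G₁⁻¹ = Δ_π − Δ⁽²⁾_π + DRD* + Q*aQ` ((3.128) after (3.134)): the `Δ_π`, `Δ⁽²⁾_π`
terms die on `π† = 1 − DRΓD*` (`RY_GpPhysY_divY_gaugePiTY`) and `RΓD* ∘ DRD* = (RΓD*DR) D* = R D*` (`RY_GpPhysY_divY_gradY_RY`).
[cite: Balaban1985BackgroundPropagators, (3.151) p.425, (3.122) p.420, (3.134) p.422] -/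
theorem RY_GpPhysY_divY_deltaOneY (hG : G ≤ B7Prop2Explicit.unitaryUnits (Matrix (Fin N) (Fin N) ℂ)) (hcf : i.cf * etaS i = 1)
    (parB : BondParY (Matrix (Fin N) (Fin N) ℂ) i) (Δ2 : BondOpY (Matrix (Fin N) (Fin N) ℂ) i)
    {U : CfgY (Matrix (Fin N) (Fin N) ℂ) i} (hU : ∀ μ x, U μ x ∈ G) :
    (RY i (parSymY i) (GpPhysY i (parSymY i)) U ∘ₗ GpPhysY i (parSymY i) U ∘ₗ divY i U) ∘ₗ
        deltaOneY i (parSymY i) parB (GpPhysY i (parSymY i)) Δ2 U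
      = RY i (parSymY i) (GpPhysY i (parSymY i)) U ∘ₗ divY i U
        + (RY i (parSymY i) (GpPhysY i (parSymY i)) U ∘ₗ GpPhysY i (parSymY i) U ∘ₗ divY i U) ∘ₗ (QsY i parB U ∘ₗ aY i ∘ₗ QY i parB U) := by
  have hkey := RY_GpPhysY_divY_gradY_RY i hG hcf hU
  have h0 : (RY i (parSymY i) (GpPhysY i (parSymY i)) U ∘ₗ GpPhysY i (parSymY i) U ∘ₗ divY i U) ∘ₗ
      gaugePiTY i (parSymY i) (GpPhysY i (parSymY i)) U = 0 := by
    rw [LinearMap.comp_assoc, LinearMap.comp_assoc]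
    exact RY_GpPhysY_divY_gaugePiTY i hG hcf hU
  have hT1 : (RY i (parSymY i) (GpPhysY i (parSymY i)) U ∘ₗ GpPhysY i (parSymY i) U ∘ₗ divY i U) ∘ₗ
      (gaugePiTY i (parSymY i) (GpPhysY i (parSymY i)) U ∘ₗ hessY i U ∘ₗ gaugePiY i (parSymY i) (GpPhysY i (parSymY i)) U) = 0 := by
    rw [← LinearMap.comp_assoc, h0, LinearMap.zero_comp]
  have hT4 : (RY i (parSymY i) (GpPhysY i (parSymY i)) U ∘ₗ GpPhysY i (parSymY i) U ∘ₗ divY i U) ∘ₗ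
      (gaugePiTY i (parSymY i) (GpPhysY i (parSymY i)) U ∘ₗ Δ2 U ∘ₗ gaugePiY i (parSymY i) (GpPhysY i (parSymY i)) U) = 0 := by
    rw [← LinearMap.comp_assoc, h0, LinearMap.zero_comp]
  have hT2 : (RY i (parSymY i) (GpPhysY i (parSymY i)) U ∘ₗ GpPhysY i (parSymY i) U ∘ₗ divY i U) ∘ₗ
      (gradY i U ∘ₗ RY i (parSymY i) (GpPhysY i (parSymY i)) U ∘ₗ divY i U)
        = RY i (parSymY i) (GpPhysY i (parSymY i)) U ∘ₗ divY i U := by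
    have h6 : (RY i (parSymY i) (GpPhysY i (parSymY i)) U ∘ₗ GpPhysY i (parSymY i) U ∘ₗ divY i U ∘ₗ gradY i U ∘ₗ
        RY i (parSymY i) (GpPhysY i (parSymY i)) U) ∘ₗ divY i U = RY i (parSymY i) (GpPhysY i (parSymY i)) U ∘ₗ divY i U := by
      rw [hkey]
    rw [LinearMap.comp_assoc, LinearMap.comp_assoc, LinearMap.comp_assoc, LinearMap.comp_assoc] at h6
    rw [LinearMap.comp_assoc, LinearMap.comp_assoc]
    exact h6
  have hM : deltaOneY i (parSymY i) parB (GpPhysY i (parSymY i)) Δ2 U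
      = (gaugePiTY i (parSymY i) (GpPhysY i (parSymY i)) U ∘ₗ hessY i U ∘ₗ gaugePiY i (parSymY i) (GpPhysY i (parSymY i)) U
          + gradY i U ∘ₗ RY i (parSymY i) (GpPhysY i (parSymY i)) U ∘ₗ divY i U + QsY i parB U ∘ₗ aY i ∘ₗ QY i parB U)
        - gaugePiTY i (parSymY i) (GpPhysY i (parSymY i)) U ∘ₗ Δ2 U ∘ₗ gaugePiY i (parSymY i) (GpPhysY i (parSymY i)) U := rfl
  rw [hM, LinearMap.comp_sub, LinearMap.comp_add, LinearMap.comp_add, hT1, hT4, hT2, zero_add, sub_zero]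

/-- ★★ **`G₁⁻¹ ∘ (D Γ R) = D R + (Q* a Q) ∘ (D Γ R)`**: the `Δ_π`, `Δ⁽²⁾_π` terms die on `π = 1 − DΓRD*` (`gaugePiY_gradY_GpPhysY_RY`) and
`DRD* ∘ DΓR = D (RD*DΓR) = D R` (`RY_divY_gradY_GpPhysY_RY`). [cite: Balaban1985BackgroundPropagators, (3.151) p.425, (3.122) p.420, (3.134) p.422] -/
theorem deltaOneY_gradY_GpPhysY_RY (hG : G ≤ B7Prop2Explicit.unitaryUnits (Matrix (Fin N) (Fin N) ℂ)) (hcf : i.cf * etaS i = 1)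
    (parB : BondParY (Matrix (Fin N) (Fin N) ℂ) i) (Δ2 : BondOpY (Matrix (Fin N) (Fin N) ℂ) i)
    {U : CfgY (Matrix (Fin N) (Fin N) ℂ) i} (hU : ∀ μ x, U μ x ∈ G) :
    deltaOneY i (parSymY i) parB (GpPhysY i (parSymY i)) Δ2 U ∘ₗ
        gradY i U ∘ₗ GpPhysY i (parSymY i) U ∘ₗ RY i (parSymY i) (GpPhysY i (parSymY i)) U
      = gradY i U ∘ₗ RY i (parSymY i) (GpPhysY i (parSymY i)) U
        + (QsY i parB U ∘ₗ aY i ∘ₗ QY i parB U) ∘ₗ gradY i U ∘ₗ GpPhysY i (parSymY i) U ∘ₗ RY i (parSymY i) (GpPhysY i (parSymY i)) U := by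
  have hkey := RY_divY_gradY_GpPhysY_RY i hG hcf hU
  have hπ := gaugePiY_gradY_GpPhysY_RY i hG hcf hU
  have hU1 : (gaugePiTY i (parSymY i) (GpPhysY i (parSymY i)) U ∘ₗ hessY i U ∘ₗ gaugePiY i (parSymY i) (GpPhysY i (parSymY i)) U) ∘ₗ
      gradY i U ∘ₗ GpPhysY i (parSymY i) U ∘ₗ RY i (parSymY i) (GpPhysY i (parSymY i)) U = 0 := by
    rw [LinearMap.comp_assoc, LinearMap.comp_assoc, hπ, LinearMap.comp_zero, LinearMap.comp_zero]
  have hU4 : (gaugePiTY i (parSymY i) (GpPhysY i (parSymY i)) U ∘ₗ Δ2 U ∘ₗ gaugePiY i (parSymY i) (GpPhysY i (parSymY i)) U) ∘ₗ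
      gradY i U ∘ₗ GpPhysY i (parSymY i) U ∘ₗ RY i (parSymY i) (GpPhysY i (parSymY i)) U = 0 := by
    rw [LinearMap.comp_assoc, LinearMap.comp_assoc, hπ, LinearMap.comp_zero, LinearMap.comp_zero]
  have hU2 : (gradY i U ∘ₗ RY i (parSymY i) (GpPhysY i (parSymY i)) U ∘ₗ divY i U) ∘ₗ
      gradY i U ∘ₗ GpPhysY i (parSymY i) U ∘ₗ RY i (parSymY i) (GpPhysY i (parSymY i)) U
        = gradY i U ∘ₗ RY i (parSymY i) (GpPhysY i (parSymY i)) U := by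
    rw [LinearMap.comp_assoc, LinearMap.comp_assoc, hkey]
  have hM : deltaOneY i (parSymY i) parB (GpPhysY i (parSymY i)) Δ2 U
      = (gaugePiTY i (parSymY i) (GpPhysY i (parSymY i)) U ∘ₗ hessY i U ∘ₗ gaugePiY i (parSymY i) (GpPhysY i (parSymY i)) U
          + gradY i U ∘ₗ RY i (parSymY i) (GpPhysY i (parSymY i)) U ∘ₗ divY i U + QsY i parB U ∘ₗ aY i ∘ₗ QY i parB U)
        - gaugePiTY i (parSymY i) (GpPhysY i (parSymY i)) U ∘ₗ Δ2 U ∘ₗ gaugePiY i (parSymY i) (GpPhysY i (parSymY i)) U := rfl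
  rw [hM, LinearMap.sub_comp, LinearMap.add_comp, LinearMap.add_comp, hU1, hU4, hU2, zero_add, sub_zero]

/-! ## §2 Wherever `G₁⁻¹` is invertible: (3.152) and (3.124) from `hZ : Q D Γ R = 0` and its transpose `hZt : R Γ D* Q* = 0` -/

/-- `R D* G₁ = R Γ D* − (R Γ D* Q* a Q) G₁` wherever `G₁⁻¹ := deltaOneY` is a unit (then `G1Y = (deltaOneY)⁻¹`).
[cite: Balaban1985BackgroundPropagators, (3.151)–(3.152) pp.425–426, (3.138) p.423] -/
theorem RY_divY_G1Y (hG : G ≤ B7Prop2Explicit.unitaryUnits (Matrix (Fin N) (Fin N) ℂ)) (hcf : i.cf * etaS i = 1)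
    (parB : BondParY (Matrix (Fin N) (Fin N) ℂ) i) (Δ2 : BondOpY (Matrix (Fin N) (Fin N) ℂ) i)
    {U : CfgY (Matrix (Fin N) (Fin N) ℂ) i} (hU : ∀ μ x, U μ x ∈ G)
    (hM1 : IsUnit (deltaOneY i (parSymY i) parB (GpPhysY i (parSymY i)) Δ2 U)) :
    (RY i (parSymY i) (GpPhysY i (parSymY i)) U ∘ₗ divY i U) ∘ₗ G1Y i (parSymY i) parB (GpPhysY i (parSymY i)) Δ2 U
      = RY i (parSymY i) (GpPhysY i (parSymY i)) U ∘ₗ GpPhysY i (parSymY i) U ∘ₗ divY i U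
        - ((RY i (parSymY i) (GpPhysY i (parSymY i)) U ∘ₗ GpPhysY i (parSymY i) U ∘ₗ divY i U) ∘ₗ
            (QsY i parB U ∘ₗ aY i ∘ₗ QY i parB U)) ∘ₗ G1Y i (parSymY i) parB (GpPhysY i (parSymY i)) Δ2 U := by
  have hinv : deltaOneY i (parSymY i) parB (GpPhysY i (parSymY i)) Δ2 U ∘ₗ G1Y i (parSymY i) parB (GpPhysY i (parSymY i)) Δ2 U
      = LinearMap.id := Ring.mul_inverse_cancel _ hM1
  have h : ((RY i (parSymY i) (GpPhysY i (parSymY i)) U ∘ₗ GpPhysY i (parSymY i) U ∘ₗ divY i U) ∘ₗ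
        deltaOneY i (parSymY i) parB (GpPhysY i (parSymY i)) Δ2 U) ∘ₗ G1Y i (parSymY i) parB (GpPhysY i (parSymY i)) Δ2 U
      = (RY i (parSymY i) (GpPhysY i (parSymY i)) U ∘ₗ divY i U
        + (RY i (parSymY i) (GpPhysY i (parSymY i)) U ∘ₗ GpPhysY i (parSymY i) U ∘ₗ divY i U) ∘ₗ (QsY i parB U ∘ₗ aY i ∘ₗ QY i parB U)) ∘ₗ
          G1Y i (parSymY i) parB (GpPhysY i (parSymY i)) Δ2 U := by
    rw [RY_GpPhysY_divY_deltaOneY i hG hcf parB Δ2 hU]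
  rw [LinearMap.comp_assoc, hinv, LinearMap.comp_id, LinearMap.add_comp] at h
  exact eq_sub_of_add_eq h.symm

/-- `G₁ D R = D Γ R − G₁ (Q* a Q D Γ R)` wherever `G₁⁻¹ := deltaOneY` is a unit. [cite: Balaban1985BackgroundPropagators, (3.151)–(3.152) pp.425–426] -/
theorem G1Y_gradY_RY (hG : G ≤ B7Prop2Explicit.unitaryUnits (Matrix (Fin N) (Fin N) ℂ)) (hcf : i.cf * etaS i = 1)
    (parB : BondParY (Matrix (Fin N) (Fin N) ℂ) i) (Δ2 : BondOpY (Matrix (Fin N) (Fin N) ℂ) i)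
    {U : CfgY (Matrix (Fin N) (Fin N) ℂ) i} (hU : ∀ μ x, U μ x ∈ G)
    (hM1 : IsUnit (deltaOneY i (parSymY i) parB (GpPhysY i (parSymY i)) Δ2 U)) :
    G1Y i (parSymY i) parB (GpPhysY i (parSymY i)) Δ2 U ∘ₗ gradY i U ∘ₗ RY i (parSymY i) (GpPhysY i (parSymY i)) U
      = gradY i U ∘ₗ GpPhysY i (parSymY i) U ∘ₗ RY i (parSymY i) (GpPhysY i (parSymY i)) U
        - G1Y i (parSymY i) parB (GpPhysY i (parSymY i)) Δ2 U ∘ₗ (QsY i parB U ∘ₗ aY i ∘ₗ QY i parB U) ∘ₗ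
            gradY i U ∘ₗ GpPhysY i (parSymY i) U ∘ₗ RY i (parSymY i) (GpPhysY i (parSymY i)) U := by
  have hinv : G1Y i (parSymY i) parB (GpPhysY i (parSymY i)) Δ2 U ∘ₗ deltaOneY i (parSymY i) parB (GpPhysY i (parSymY i)) Δ2 U
      = LinearMap.id := Ring.inverse_mul_cancel _ hM1
  have h : G1Y i (parSymY i) parB (GpPhysY i (parSymY i)) Δ2 U ∘ₗ (deltaOneY i (parSymY i) parB (GpPhysY i (parSymY i)) Δ2 U ∘ₗ
        gradY i U ∘ₗ GpPhysY i (parSymY i) U ∘ₗ RY i (parSymY i) (GpPhysY i (parSymY i)) U)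
      = G1Y i (parSymY i) parB (GpPhysY i (parSymY i)) Δ2 U ∘ₗ (gradY i U ∘ₗ RY i (parSymY i) (GpPhysY i (parSymY i)) U
        + (QsY i parB U ∘ₗ aY i ∘ₗ QY i parB U) ∘ₗ gradY i U ∘ₗ GpPhysY i (parSymY i) U ∘ₗ RY i (parSymY i) (GpPhysY i (parSymY i)) U) := by
    rw [deltaOneY_gradY_GpPhysY_RY i hG hcf parB Δ2 hU]
  rw [← LinearMap.comp_assoc, hinv, LinearMap.id_comp, LinearMap.comp_add] at h
  exact eq_sub_of_add_eq h.symm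

/-- ★★ **(3.152), first half: `R D* G₁ = R Γ D*`** — from the transposed constraint `hZt : R Γ D* Q* = 0`.
[cite: Balaban1985BackgroundPropagators, (3.152) p.426] -/
theorem RY_divY_G1Y_of_hZt (hG : G ≤ B7Prop2Explicit.unitaryUnits (Matrix (Fin N) (Fin N) ℂ)) (hcf : i.cf * etaS i = 1)
    (parB : BondParY (Matrix (Fin N) (Fin N) ℂ) i) (Δ2 : BondOpY (Matrix (Fin N) (Fin N) ℂ) i)
    {U : CfgY (Matrix (Fin N) (Fin N) ℂ) i} (hU : ∀ μ x, U μ x ∈ G)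
    (hM1 : IsUnit (deltaOneY i (parSymY i) parB (GpPhysY i (parSymY i)) Δ2 U))
    (hZt : RY i (parSymY i) (GpPhysY i (parSymY i)) U ∘ₗ GpPhysY i (parSymY i) U ∘ₗ divY i U ∘ₗ QsY i parB U = 0) :
    RY i (parSymY i) (GpPhysY i (parSymY i)) U ∘ₗ divY i U ∘ₗ G1Y i (parSymY i) parB (GpPhysY i (parSymY i)) Δ2 U
      = RY i (parSymY i) (GpPhysY i (parSymY i)) U ∘ₗ GpPhysY i (parSymY i) U ∘ₗ divY i U := by
  have hZt' : (RY i (parSymY i) (GpPhysY i (parSymY i)) U ∘ₗ GpPhysY i (parSymY i) U ∘ₗ divY i U) ∘ₗ QsY i parB U = 0 := by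
    rw [LinearMap.comp_assoc, LinearMap.comp_assoc]
    exact hZt
  have hz : (RY i (parSymY i) (GpPhysY i (parSymY i)) U ∘ₗ GpPhysY i (parSymY i) U ∘ₗ divY i U) ∘ₗ (QsY i parB U ∘ₗ aY i ∘ₗ QY i parB U)
      = 0 := by
    rw [← LinearMap.comp_assoc, hZt', LinearMap.zero_comp]
  have h := RY_divY_G1Y i hG hcf parB Δ2 hU hM1
  rw [hz, LinearMap.zero_comp, sub_zero, LinearMap.comp_assoc] at h
  exact h

/-- ★★ **(3.124), middle: `R D* G₁ Q* = 0`** — from `hZt`. [cite: Balaban1985BackgroundPropagators, (3.124) p.420, (3.152) p.426] -/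
theorem RY_divY_G1Y_QsY_of_hZt (hG : G ≤ B7Prop2Explicit.unitaryUnits (Matrix (Fin N) (Fin N) ℂ)) (hcf : i.cf * etaS i = 1)
    (parB : BondParY (Matrix (Fin N) (Fin N) ℂ) i) (Δ2 : BondOpY (Matrix (Fin N) (Fin N) ℂ) i)
    {U : CfgY (Matrix (Fin N) (Fin N) ℂ) i} (hU : ∀ μ x, U μ x ∈ G)
    (hM1 : IsUnit (deltaOneY i (parSymY i) parB (GpPhysY i (parSymY i)) Δ2 U))
    (hZt : RY i (parSymY i) (GpPhysY i (parSymY i)) U ∘ₗ GpPhysY i (parSymY i) U ∘ₗ divY i U ∘ₗ QsY i parB U = 0) :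
    RY i (parSymY i) (GpPhysY i (parSymY i)) U ∘ₗ divY i U ∘ₗ G1Y i (parSymY i) parB (GpPhysY i (parSymY i)) Δ2 U ∘ₗ QsY i parB U = 0 := by
  have h1 := RY_divY_G1Y_of_hZt i hG hcf parB Δ2 hU hM1 hZt
  have hZt' : (RY i (parSymY i) (GpPhysY i (parSymY i)) U ∘ₗ GpPhysY i (parSymY i) U ∘ₗ divY i U) ∘ₗ QsY i parB U = 0 := by
    rw [LinearMap.comp_assoc, LinearMap.comp_assoc]
    exact hZt
  have h2 : (RY i (parSymY i) (GpPhysY i (parSymY i)) U ∘ₗ divY i U ∘ₗ G1Y i (parSymY i) parB (GpPhysY i (parSymY i)) Δ2 U) ∘ₗ QsY i parB U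
      = (RY i (parSymY i) (GpPhysY i (parSymY i)) U ∘ₗ GpPhysY i (parSymY i) U ∘ₗ divY i U) ∘ₗ QsY i parB U := by
    rw [h1]
  rw [hZt', LinearMap.comp_assoc, LinearMap.comp_assoc] at h2
  exact h2

/-- ★★ **(3.124), right: `R D* G₁ D R = R`** — from `hZt` (and `R Γ D* D R = R`). [cite: Balaban1985BackgroundPropagators, (3.124) p.420] -/
theorem RY_divY_G1Y_gradY_RY_of_hZt (hG : G ≤ B7Prop2Explicit.unitaryUnits (Matrix (Fin N) (Fin N) ℂ)) (hcf : i.cf * etaS i = 1)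
    (parB : BondParY (Matrix (Fin N) (Fin N) ℂ) i) (Δ2 : BondOpY (Matrix (Fin N) (Fin N) ℂ) i)
    {U : CfgY (Matrix (Fin N) (Fin N) ℂ) i} (hU : ∀ μ x, U μ x ∈ G)
    (hM1 : IsUnit (deltaOneY i (parSymY i) parB (GpPhysY i (parSymY i)) Δ2 U))
    (hZt : RY i (parSymY i) (GpPhysY i (parSymY i)) U ∘ₗ GpPhysY i (parSymY i) U ∘ₗ divY i U ∘ₗ QsY i parB U = 0) :
    RY i (parSymY i) (GpPhysY i (parSymY i)) U ∘ₗ divY i U ∘ₗ G1Y i (parSymY i) parB (GpPhysY i (parSymY i)) Δ2 U ∘ₗ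
        gradY i U ∘ₗ RY i (parSymY i) (GpPhysY i (parSymY i)) U = RY i (parSymY i) (GpPhysY i (parSymY i)) U := by
  have h1 := RY_divY_G1Y_of_hZt i hG hcf parB Δ2 hU hM1 hZt
  have h2 : (RY i (parSymY i) (GpPhysY i (parSymY i)) U ∘ₗ divY i U ∘ₗ G1Y i (parSymY i) parB (GpPhysY i (parSymY i)) Δ2 U) ∘ₗ
        (gradY i U ∘ₗ RY i (parSymY i) (GpPhysY i (parSymY i)) U)
      = (RY i (parSymY i) (GpPhysY i (parSymY i)) U ∘ₗ GpPhysY i (parSymY i) U ∘ₗ divY i U) ∘ₗ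
        (gradY i U ∘ₗ RY i (parSymY i) (GpPhysY i (parSymY i)) U) := by
    rw [h1]
  rw [LinearMap.comp_assoc, LinearMap.comp_assoc, LinearMap.comp_assoc, LinearMap.comp_assoc, RY_GpPhysY_divY_gradY_RY i hG hcf hU] at h2
  exact h2

/-- ★★ **(3.152), second half: `G₁ D R = D Γ R`** — from `hZ : Q D Γ R = 0` (print: «QDG′R = D₁Q′G′R = 0», (3.115) with `Q′G′R = 0`).
[cite: Balaban1985BackgroundPropagators, (3.152) p.426, (3.115) p.418] -/
theorem G1Y_gradY_RY_of_hZ (hG : G ≤ B7Prop2Explicit.unitaryUnits (Matrix (Fin N) (Fin N) ℂ)) (hcf : i.cf * etaS i = 1)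
    (parB : BondParY (Matrix (Fin N) (Fin N) ℂ) i) (Δ2 : BondOpY (Matrix (Fin N) (Fin N) ℂ) i)
    {U : CfgY (Matrix (Fin N) (Fin N) ℂ) i} (hU : ∀ μ x, U μ x ∈ G)
    (hM1 : IsUnit (deltaOneY i (parSymY i) parB (GpPhysY i (parSymY i)) Δ2 U))
    (hZ : QY i parB U ∘ₗ gradY i U ∘ₗ GpPhysY i (parSymY i) U ∘ₗ RY i (parSymY i) (GpPhysY i (parSymY i)) U = 0) :
    G1Y i (parSymY i) parB (GpPhysY i (parSymY i)) Δ2 U ∘ₗ gradY i U ∘ₗ RY i (parSymY i) (GpPhysY i (parSymY i)) U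
      = gradY i U ∘ₗ GpPhysY i (parSymY i) U ∘ₗ RY i (parSymY i) (GpPhysY i (parSymY i)) U := by
  have hinv : G1Y i (parSymY i) parB (GpPhysY i (parSymY i)) Δ2 U ∘ₗ deltaOneY i (parSymY i) parB (GpPhysY i (parSymY i)) Δ2 U
      = LinearMap.id := Ring.inverse_mul_cancel _ hM1
  have hz : (QsY i parB U ∘ₗ aY i ∘ₗ QY i parB U) ∘ₗ gradY i U ∘ₗ GpPhysY i (parSymY i) U ∘ₗ RY i (parSymY i) (GpPhysY i (parSymY i)) U
      = 0 := by
    rw [LinearMap.comp_assoc, LinearMap.comp_assoc, hZ, LinearMap.comp_zero, LinearMap.comp_zero]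
  have h := deltaOneY_gradY_GpPhysY_RY i hG hcf parB Δ2 hU
  rw [hz, add_zero] at h
  have h2 : G1Y i (parSymY i) parB (GpPhysY i (parSymY i)) Δ2 U ∘ₗ (deltaOneY i (parSymY i) parB (GpPhysY i (parSymY i)) Δ2 U ∘ₗ
        gradY i U ∘ₗ GpPhysY i (parSymY i) U ∘ₗ RY i (parSymY i) (GpPhysY i (parSymY i)) U)
      = G1Y i (parSymY i) parB (GpPhysY i (parSymY i)) Δ2 U ∘ₗ (gradY i U ∘ₗ RY i (parSymY i) (GpPhysY i (parSymY i)) U) := by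
    rw [h]
  rw [← LinearMap.comp_assoc, hinv, LinearMap.id_comp] at h2
  exact h2.symm

/-- ★★ **(3.124), left: `Q G₁ D R = 0`** — from `hZ`. [cite: Balaban1985BackgroundPropagators, (3.124) p.420, (3.152) p.426] -/
theorem QY_G1Y_gradY_RY_of_hZ (hG : G ≤ B7Prop2Explicit.unitaryUnits (Matrix (Fin N) (Fin N) ℂ)) (hcf : i.cf * etaS i = 1)
    (parB : BondParY (Matrix (Fin N) (Fin N) ℂ) i) (Δ2 : BondOpY (Matrix (Fin N) (Fin N) ℂ) i)
    {U : CfgY (Matrix (Fin N) (Fin N) ℂ) i} (hU : ∀ μ x, U μ x ∈ G)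
    (hM1 : IsUnit (deltaOneY i (parSymY i) parB (GpPhysY i (parSymY i)) Δ2 U))
    (hZ : QY i parB U ∘ₗ gradY i U ∘ₗ GpPhysY i (parSymY i) U ∘ₗ RY i (parSymY i) (GpPhysY i (parSymY i)) U = 0) :
    QY i parB U ∘ₗ G1Y i (parSymY i) parB (GpPhysY i (parSymY i)) Δ2 U ∘ₗ gradY i U ∘ₗ RY i (parSymY i) (GpPhysY i (parSymY i)) U = 0 := by
  rw [G1Y_gradY_RY_of_hZ i hG hcf parB Δ2 hU hM1 hZ]
  exact hZ

/-- ★★ **(3.124), right: `R D* G₁ D R = R`** — from `hZ` this time (and `R D* D Γ R = R`). [cite: Balaban1985BackgroundPropagators, (3.124) p.420] -/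
theorem RY_divY_G1Y_gradY_RY_of_hZ (hG : G ≤ B7Prop2Explicit.unitaryUnits (Matrix (Fin N) (Fin N) ℂ)) (hcf : i.cf * etaS i = 1)
    (parB : BondParY (Matrix (Fin N) (Fin N) ℂ) i) (Δ2 : BondOpY (Matrix (Fin N) (Fin N) ℂ) i)
    {U : CfgY (Matrix (Fin N) (Fin N) ℂ) i} (hU : ∀ μ x, U μ x ∈ G)
    (hM1 : IsUnit (deltaOneY i (parSymY i) parB (GpPhysY i (parSymY i)) Δ2 U))
    (hZ : QY i parB U ∘ₗ gradY i U ∘ₗ GpPhysY i (parSymY i) U ∘ₗ RY i (parSymY i) (GpPhysY i (parSymY i)) U = 0) :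
    RY i (parSymY i) (GpPhysY i (parSymY i)) U ∘ₗ divY i U ∘ₗ G1Y i (parSymY i) parB (GpPhysY i (parSymY i)) Δ2 U ∘ₗ
        gradY i U ∘ₗ RY i (parSymY i) (GpPhysY i (parSymY i)) U = RY i (parSymY i) (GpPhysY i (parSymY i)) U := by
  rw [G1Y_gradY_RY_of_hZ i hG hcf parB Δ2 hU hM1 hZ]
  exact RY_divY_gradY_GpPhysY_RY i hG hcf hU

/-- ★★★ **THE REDUCTION**: at a `G`-valued background (`G ≤ U(N)`), in print's units (`c_f η = 1`), wherever `G₁⁻¹` (3.128) is invertible,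
the pair of constraints `hZ : Q D Γ R = 0`, `hZt : R Γ D* Q* = 0` yields all five displayed identities of the knit:
(3.152) `R D* G₁ = R Γ D*`, `G₁ D R = D Γ R` and (3.124) `Q G₁ D R = 0`, `R D* G₁ Q* = 0`, `R D* G₁ D R = R`.
[cite: Balaban1985BackgroundPropagators, (3.152) p.426, (3.124) p.420, (3.115) p.418] -/
theorem ids3152_ids3124_of_hZ_hZt (hG : G ≤ B7Prop2Explicit.unitaryUnits (Matrix (Fin N) (Fin N) ℂ)) (hcf : i.cf * etaS i = 1)
    (parB : BondParY (Matrix (Fin N) (Fin N) ℂ) i) (Δ2 : BondOpY (Matrix (Fin N) (Fin N) ℂ) i)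
    {U : CfgY (Matrix (Fin N) (Fin N) ℂ) i} (hU : ∀ μ x, U μ x ∈ G)
    (hM1 : IsUnit (deltaOneY i (parSymY i) parB (GpPhysY i (parSymY i)) Δ2 U))
    (hZ : QY i parB U ∘ₗ gradY i U ∘ₗ GpPhysY i (parSymY i) U ∘ₗ RY i (parSymY i) (GpPhysY i (parSymY i)) U = 0)
    (hZt : RY i (parSymY i) (GpPhysY i (parSymY i)) U ∘ₗ GpPhysY i (parSymY i) U ∘ₗ divY i U ∘ₗ QsY i parB U = 0) :
    (RY i (parSymY i) (GpPhysY i (parSymY i)) U ∘ₗ divY i U ∘ₗ G1Y i (parSymY i) parB (GpPhysY i (parSymY i)) Δ2 U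
        = RY i (parSymY i) (GpPhysY i (parSymY i)) U ∘ₗ GpPhysY i (parSymY i) U ∘ₗ divY i U)
    ∧ (G1Y i (parSymY i) parB (GpPhysY i (parSymY i)) Δ2 U ∘ₗ gradY i U ∘ₗ RY i (parSymY i) (GpPhysY i (parSymY i)) U
        = gradY i U ∘ₗ GpPhysY i (parSymY i) U ∘ₗ RY i (parSymY i) (GpPhysY i (parSymY i)) U)
    ∧ QY i parB U ∘ₗ G1Y i (parSymY i) parB (GpPhysY i (parSymY i)) Δ2 U ∘ₗ gradY i U ∘ₗ RY i (parSymY i) (GpPhysY i (parSymY i)) U = 0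
    ∧ RY i (parSymY i) (GpPhysY i (parSymY i)) U ∘ₗ divY i U ∘ₗ G1Y i (parSymY i) parB (GpPhysY i (parSymY i)) Δ2 U ∘ₗ QsY i parB U = 0
    ∧ RY i (parSymY i) (GpPhysY i (parSymY i)) U ∘ₗ divY i U ∘ₗ G1Y i (parSymY i) parB (GpPhysY i (parSymY i)) Δ2 U ∘ₗ
        gradY i U ∘ₗ RY i (parSymY i) (GpPhysY i (parSymY i)) U = RY i (parSymY i) (GpPhysY i (parSymY i)) U :=
  ⟨RY_divY_G1Y_of_hZt i hG hcf parB Δ2 hU hM1 hZt, G1Y_gradY_RY_of_hZ i hG hcf parB Δ2 hU hM1 hZ,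
    QY_G1Y_gradY_RY_of_hZ i hG hcf parB Δ2 hU hM1 hZ, RY_divY_G1Y_QsY_of_hZt i hG hcf parB Δ2 hU hM1 hZt,
    RY_divY_G1Y_gradY_RY_of_hZ i hG hcf parB Δ2 hU hM1 hZ⟩

end Reduction

/-! ## §3 The transpose comes for free: `hZ → hZt` by the trace-adjoint calculus (`Q* = Q†` (3.13), `D* = D†` (3.8), `Γ`, `R` symmetric) -/

section Adjoint

variable {N : ℕ} {X Y : Type} [Fintype X] [Fintype Y]

/-- nondegeneracy of print's scalar products: if `B` is the trace-adjoint of `A` (positive source weights) and `A = 0`, then `B = 0`.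
[cite: Balaban1985BackgroundPropagators, p.393 (scalar products); folklore] -/
theorem eq_zero_of_isAdjTr_eq_zero {wX : X → ℝ} {wY : Y → ℝ} (hwX : ∀ s, 0 < wX s)
    {A : (X → Matrix (Fin N) (Fin N) ℂ) →ₗ[ℂ] (Y → Matrix (Fin N) (Fin N) ℂ)} {B : (Y → Matrix (Fin N) (Fin N) ℂ) →ₗ[ℂ] (X → Matrix (Fin N) (Fin N) ℂ)}
    (h : IsAdjTr wX wY A B) (hA : A = 0) : B = 0 := by
  refine LinearMap.ext fun Ψ => ?_
  rw [LinearMap.zero_apply]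
  by_contra hne
  have hpos := trIP_self_pos wX hwX hne
  have h1 := h (B Ψ) Ψ
  rw [hA, LinearMap.zero_apply, trIP_comm, trIP_zero_right] at h1
  exact hpos.ne h1

end Adjoint

section OneBinder

open scoped Matrix.Norms.L2Operator

variable {N : ℕ} (i : KIdx d ℓ hd hL b₀ b₁) {G : Subgroup (Matrix (Fin N) (Fin N) ℂ)ˣ}

/-- ★★ **`hZ → hZt`**: at a `G`-valued background with a `G`-valued bond transporter table (`G ≤ U(N)`), `Q D Γ R = 0` implies its transpose
`R Γ D* Q* = 0` — `Q*`∕`D*` are the trace-adjoints of `Q`∕`D` ((3.13), (3.8): `isAdjTr_QY_QsY`, `isAdjTr_gradY_divY`), `Γ = G′_phys` and `R` are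
symmetric (`isSymmTr_GpPhysY_parSymY`, `RY_parSymY_isSymmTr`), and the pairing is nondegenerate.
[cite: Balaban1985BackgroundPropagators, (3.8) p.392, (3.13) p.393, (3.25) p.395, p.426] -/
theorem RY_GpPhysY_divY_QsY_of_hZ (hG : G ≤ B7Prop2Explicit.unitaryUnits (Matrix (Fin N) (Fin N) ℂ))
    (parB : BondParY (Matrix (Fin N) (Fin N) ℂ) i) {U : CfgY (Matrix (Fin N) (Fin N) ℂ) i} (hU : ∀ μ x, U μ x ∈ G)
    (hparB : ∀ s s', parB U s s' ∈ G)
    (hZ : QY i parB U ∘ₗ gradY i U ∘ₗ GpPhysY i (parSymY i) U ∘ₗ RY i (parSymY i) (GpPhysY i (parSymY i)) U = 0) :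
    RY i (parSymY i) (GpPhysY i (parSymY i)) U ∘ₗ GpPhysY i (parSymY i) U ∘ₗ divY i U ∘ₗ QsY i parB U = 0 := by
  have hU' : ∀ μ x, ((U μ x : (Matrix (Fin N) (Fin N) ℂ)ˣ) : Matrix (Fin N) (Fin N) ℂ) ∈ unitary (Matrix (Fin N) (Fin N) ℂ) :=
    fun μ x => hG (hU μ x)
  have hR : IsSymmTr (fun _ => (1 : ℝ)) (RY i (parSymY i) (GpPhysY i (parSymY i)) U) := by
    rw [RY_GpPhysY]
    exact RY_parSymY_isSymmTr i hG hU
  have h1 : IsAdjTr (fun _ => (1 : ℝ)) (fun _ => (1 : ℝ)) (GpPhysY i (parSymY i) U ∘ₗ RY i (parSymY i) (GpPhysY i (parSymY i)) U)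
      (RY i (parSymY i) (GpPhysY i (parSymY i)) U ∘ₗ GpPhysY i (parSymY i) U) :=
    isAdjTr_comp (isAdjTr_of_isSymmTr (isSymmTr_GpPhysY_parSymY i hG hU)) (isAdjTr_of_isSymmTr hR)
  have h2 : IsAdjTr (fun _ => (1 : ℝ)) (fun _ => (1 : ℝ))
      (gradY i U ∘ₗ GpPhysY i (parSymY i) U ∘ₗ RY i (parSymY i) (GpPhysY i (parSymY i)) U)
      ((RY i (parSymY i) (GpPhysY i (parSymY i)) U ∘ₗ GpPhysY i (parSymY i) U) ∘ₗ divY i U) :=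
    isAdjTr_comp (isAdjTr_gradY_divY i U hU') h1
  have h3 : IsAdjTr (fun _ => (1 : ℝ)) (fun _ => (1 : ℝ))
      (QY i parB U ∘ₗ gradY i U ∘ₗ GpPhysY i (parSymY i) U ∘ₗ RY i (parSymY i) (GpPhysY i (parSymY i)) U)
      (((RY i (parSymY i) (GpPhysY i (parSymY i)) U ∘ₗ GpPhysY i (parSymY i) U) ∘ₗ divY i U) ∘ₗ QsY i parB U) :=
    isAdjTr_comp (isAdjTr_QY_QsY i hG parB U hparB) h2
  have h4 := eq_zero_of_isAdjTr_eq_zero (fun _ => one_pos) h3 hZ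
  rw [LinearMap.comp_assoc, LinearMap.comp_assoc] at h4
  exact h4

/-- ★★★ **THE REDUCTION, ONE BINDER**: at a `G`-valued background and bond table (`G ≤ U(N)`), in print's units, wherever `G₁⁻¹` (3.128) is
invertible, the single constraint `hZ : Q D Γ R = 0` (print p. 426: «QDG′R = D₁Q′G′R = 0») yields (3.152) `R D* G₁ = R Γ D*`, `G₁ D R = D Γ R`
and (3.124) `Q G₁ D R = 0`, `R D* G₁ Q* = 0`, `R D* G₁ D R = R`. [cite: Balaban1985BackgroundPropagators, (3.152) p.426, (3.124) p.420, (3.115) p.418] -/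
theorem ids3152_ids3124_of_hZ (hG : G ≤ B7Prop2Explicit.unitaryUnits (Matrix (Fin N) (Fin N) ℂ)) (hcf : i.cf * etaS i = 1)
    (parB : BondParY (Matrix (Fin N) (Fin N) ℂ) i) (Δ2 : BondOpY (Matrix (Fin N) (Fin N) ℂ) i)
    {U : CfgY (Matrix (Fin N) (Fin N) ℂ) i} (hU : ∀ μ x, U μ x ∈ G) (hparB : ∀ s s', parB U s s' ∈ G)
    (hM1 : IsUnit (deltaOneY i (parSymY i) parB (GpPhysY i (parSymY i)) Δ2 U))
    (hZ : QY i parB U ∘ₗ gradY i U ∘ₗ GpPhysY i (parSymY i) U ∘ₗ RY i (parSymY i) (GpPhysY i (parSymY i)) U = 0) :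
    (RY i (parSymY i) (GpPhysY i (parSymY i)) U ∘ₗ divY i U ∘ₗ G1Y i (parSymY i) parB (GpPhysY i (parSymY i)) Δ2 U
        = RY i (parSymY i) (GpPhysY i (parSymY i)) U ∘ₗ GpPhysY i (parSymY i) U ∘ₗ divY i U)
    ∧ (G1Y i (parSymY i) parB (GpPhysY i (parSymY i)) Δ2 U ∘ₗ gradY i U ∘ₗ RY i (parSymY i) (GpPhysY i (parSymY i)) U
        = gradY i U ∘ₗ GpPhysY i (parSymY i) U ∘ₗ RY i (parSymY i) (GpPhysY i (parSymY i)) U)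
    ∧ QY i parB U ∘ₗ G1Y i (parSymY i) parB (GpPhysY i (parSymY i)) Δ2 U ∘ₗ gradY i U ∘ₗ RY i (parSymY i) (GpPhysY i (parSymY i)) U = 0
    ∧ RY i (parSymY i) (GpPhysY i (parSymY i)) U ∘ₗ divY i U ∘ₗ G1Y i (parSymY i) parB (GpPhysY i (parSymY i)) Δ2 U ∘ₗ QsY i parB U = 0
    ∧ RY i (parSymY i) (GpPhysY i (parSymY i)) U ∘ₗ divY i U ∘ₗ G1Y i (parSymY i) parB (GpPhysY i (parSymY i)) Δ2 U ∘ₗ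
        gradY i U ∘ₗ RY i (parSymY i) (GpPhysY i (parSymY i)) U = RY i (parSymY i) (GpPhysY i (parSymY i)) U :=
  ids3152_ids3124_of_hZ_hZt i hG hcf parB Δ2 hU hM1 hZ (RY_GpPhysY_divY_QsY_of_hZ i hG parB hU hparB hZ)

/-- ★★★ the same at def-Y's taxicab bond transporters `parBY` (the record's `Q`, `Q*`), where `hparB` is `parBY_mem`.
[cite: Balaban1985BackgroundPropagators, (3.152) p.426, (3.124) p.420, (3.35) p.396] -/
theorem ids3152_ids3124_of_hZ_parBY (hG : G ≤ B7Prop2Explicit.unitaryUnits (Matrix (Fin N) (Fin N) ℂ)) (hcf : i.cf * etaS i = 1)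
    (Δ2 : BondOpY (Matrix (Fin N) (Fin N) ℂ) i) {U : CfgY (Matrix (Fin N) (Fin N) ℂ) i} (hU : ∀ μ x, U μ x ∈ G)
    (hM1 : IsUnit (deltaOneY i (parSymY i) (parBY i) (GpPhysY i (parSymY i)) Δ2 U))
    (hZ : QY i (parBY i) U ∘ₗ gradY i U ∘ₗ GpPhysY i (parSymY i) U ∘ₗ RY i (parSymY i) (GpPhysY i (parSymY i)) U = 0) :
    (RY i (parSymY i) (GpPhysY i (parSymY i)) U ∘ₗ divY i U ∘ₗ G1Y i (parSymY i) (parBY i) (GpPhysY i (parSymY i)) Δ2 U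
        = RY i (parSymY i) (GpPhysY i (parSymY i)) U ∘ₗ GpPhysY i (parSymY i) U ∘ₗ divY i U)
    ∧ (G1Y i (parSymY i) (parBY i) (GpPhysY i (parSymY i)) Δ2 U ∘ₗ gradY i U ∘ₗ RY i (parSymY i) (GpPhysY i (parSymY i)) U
        = gradY i U ∘ₗ GpPhysY i (parSymY i) U ∘ₗ RY i (parSymY i) (GpPhysY i (parSymY i)) U)
    ∧ QY i (parBY i) U ∘ₗ G1Y i (parSymY i) (parBY i) (GpPhysY i (parSymY i)) Δ2 U ∘ₗ gradY i U ∘ₗ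
        RY i (parSymY i) (GpPhysY i (parSymY i)) U = 0
    ∧ RY i (parSymY i) (GpPhysY i (parSymY i)) U ∘ₗ divY i U ∘ₗ G1Y i (parSymY i) (parBY i) (GpPhysY i (parSymY i)) Δ2 U ∘ₗ
        QsY i (parBY i) U = 0
    ∧ RY i (parSymY i) (GpPhysY i (parSymY i)) U ∘ₗ divY i U ∘ₗ G1Y i (parSymY i) (parBY i) (GpPhysY i (parSymY i)) Δ2 U ∘ₗ
        gradY i U ∘ₗ RY i (parSymY i) (GpPhysY i (parSymY i)) U = RY i (parSymY i) (GpPhysY i (parSymY i)) U :=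
  ids3152_ids3124_of_hZ i hG hcf (parBY i) Δ2 hU (fun s s' => parBY_mem i hU s s') hM1 hZ

end OneBinder

end

end Literature.MathematicalPhysics.QuantumFieldTheory.Balaban1983to89.Node00
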